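import Literature.MathematicalPhysics.QuantumFieldTheory.Balaban1983to89.B8Prop5TraceFree
import Literature.MathematicalPhysics.QuantumFieldTheory.Balaban1983to89.B8LambdaSpaceKLevelOn

/-!
# `Balaban1983to89.B8Prop5ContractionKLevelPer` — [Balaban1985RegularSpaces] Prop. 5 (pp. 92–94): the fixed point of (1.100) for the
# nonlinearity of (1.88), at `k` levels, RUN ON THE `P`-PERIODIC CONFIGURATIONS (the Sect.-E data `gpar`, `Eterm` controlled at periodic `λ` only),
# with its reality and `τ`-freeness (sub-row «G-B8-T2S», RULING #4 v3, layer 3(b) of `lit-balaban-t2s-1/g2/V3-DESIGN.md`)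

statement-level skeleton of published theorems with citation tags; proofs where landed; nothing here is a claim about the
Yang–Mills mass gap

T. Bałaban, *Spaces of regular gauge field configurations on a lattice and gauge fixing conditions*, Commun. Math. Phys. **99** (1985) 75–102
`[Balaban1985RegularSpaces]` ("B8"): (1.95)–(1.99) pp. 92–93, (1.100)–(1.103) p. 93, (1.106), (1.107)–(1.108) p. 94, (1.17) p. 78, p. 77 («Ω_j = T_η»).
STATUS: published, refereed.

CITATION HEADER (lean-in-tree rule).  Cell `lit-balaban`, seat `lit-balaban-t2s-1` (gen 2).  WHAT IS PROVED.
* §1 `psiP5_bd2_at`, `psiP5_sub_bd2_at` — `B8Prop5PsiBounds.psiP5_bd2 ∕ psiP5_sub_bd2` ((1.98)R + (1.99), (1.106)) with the sizes∕moduli of `gpar`,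
  `Eterm` read AT THE ONE (resp. TWO) configuration(s) `λ` (`λ, λ′`, modulus `δ`) instead of on the whole ball — same proofs.
* §1 `propFive_fixedPoint_kLevel_per`, `propFive_fixedPoint_kLevel_spec_per` — `B8Prop5ContractionKLevel.propFive_fixedPoint_kLevel(_spec)` VERBATIM
  except: `hg0`, `hg1`, `hgL`, `hE0`, `hEL` (in the torus run: Sect. E's `D′(u₁⁻¹, −iλ)`, available at PERIODIC `λ` only under RULING #4) assumed for
  `P`-PERIODIC `λ_s`, `λ_t`; `G′` periodic-valued (`hGper`, e.g. `G′∘π` of `B8Thm2TorusLettersPerConv`); contraction =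
  `B8LambdaSpaceKLevelOn.fixedPoint_kLevel_per`; conclusion: EXACTLY ONE `P`-periodic fixed point in the ¼α₄-ball.
* §2 `psiP5_real_at`, `psiP5_traceFree_at` (the invariance steps of `B8Prop5Reality` ∕ `B8Prop5TraceFree` at one `λ`),
  `propFive_fixedPoint_kLevel_selfAdjoint_per`, ★ `propFive_fixedPoint_kLevel_traceFree_per` (the periodic fixed point is Hermitian ∕ `τ`-free).

HONEST SCOPE.  Verbatim re-threads; [4], (1.99), Sect. E NOT proved (displayed hypotheses); no engine above this file re-run here; count-neutral;
N05 ∕ `stub_PV3A` NOT discharged; nothing continuum ∕ ℝ⁴ ∕ OS ∕ mass-gap ∕ Clay — the Yang–Mills mass gap is NOT proved.  No `sorry`, no `def`, no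
`… : Prop` fact, no `instance`, no `notation`.
-/

noncomputable section

open NormedSpace Metric Set Filter Topology
open Complex (I)

namespace Literature.MathematicalPhysics.QuantumFieldTheory.Balaban1983to89.B8Prop5ContractionKLevelPer

open MatrixLog (mlog)
open B7Prop1Explicit (e expUnit)
open B7Prop2Explicit (unitaryUnits)
open B7Eq78Linearization (conjR conjR_apply conjR_add conjR_sub conjR_smul)
open B8Ineq132 (covDerivFwd covDeriv)
open B8LambdaSpaceKLevel (wt lamSubK lamOf norm_le_iff)
open B8LambdaSpaceKLevelOn (fixedPoint_kLevel_per fixedPoint_kLevel_per_selfAdjoint fixedPoint_kLevel_on perSet isClosed_perSet zero_mem_perSet)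
open B8Prop5ContractionKLevel (Bd2 Zsol Vop Wsrc PsiP5 Mc Kc mWc KWc mWc_nonneg KWc_nonneg Vop_sub norm_Vop_le norm_Vop_sub_Vop_le bd2_zsol
  bd2_zsol_sub_zsol zsol_eq wt_sq_norm_Wsrc_le wt_sq_norm_Wsrc_sub_le Bd2.neg Bd2.mono)
open B8Prop5Reality (isSelfAdjoint_Wsrc isSelfAdjoint_Vop isSelfAdjoint_zsol)
open B8Prop5TraceFree (apply_Wsrc apply_Vop apply_zsol isClosed_traceFree_and_zero_mem)

-- `Site` alone could resolve to the torus sites of `Setup.lean`; re-export the `ℤ^d` sites of `B7Prop1Explicit`.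
export B7Prop1Explicit (Site)

variable {d : ℕ}

/-! ## §1 The contraction on the periodic configurations -/

section General

variable {𝔸 : Type*} [NormedRing 𝔸] [NormOneClass 𝔸] [NormedAlgebra ℂ 𝔸] [CompleteSpace 𝔸]
variable {L k : ℕ} {η : ℝ} {Ω : ℕ → Set (Site d)} {Eb : ℕ → Set (Site d × Fin d)} {U₀ : Site d → Fin d → 𝔸ˣ}
  {A : Site d → Fin d → 𝔸} {DA : Site d → 𝔸}

/-- **(1.98)R + (1.99) for `Ψ = R(−Z_λ)` AT ONE `λ`**: `|Ψ(λ)|₍₋₂₎ ≤ M` from the sizes of `λ′ = gpar λ`, `Eterm λ`, `A`, `D*A` at that `λ`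
(`B8Prop5PsiBounds.psiP5_bd2`, hypotheses read at `λ`). [cite: Balaban1985RegularSpaces, (1.98)–(1.99) pp.92–93] -/
theorem psiP5_bd2_at (hL : 1 ≤ L) (hη : 0 < η) (R gpar Eterm : (Site d → 𝔸) → (Site d → 𝔸))
    {BR a₁ b₁ cA cDA mE : ℝ}
    (hBR : 0 ≤ BR) (ha₁ : 0 ≤ a₁) (ha₁' : a₁ ≤ 1 / 24) (hb₁ : 0 < b₁) (hb₁' : b₁ ≤ 1 / 140)
    (hcA : 0 ≤ cA) (hcA' : cA ≤ 1 / 13) (hcDA : 0 ≤ cDA) (hmE : 0 ≤ mE) (hθ : 10 * a₁ * BR ≤ 1 / 2)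
    (hRsub : ∀ f g : Site d → 𝔸, R (f - g) = R f - R g)
    (hRbd : ∀ (f : Site d → 𝔸) (m : ℝ), 0 ≤ m → Bd2 L η k Ω f m → Bd2 L η k Ω (R f) (BR * m))
    {lam : Site d → 𝔸} (hg0 : ∀ j, j ≤ k → ∀ x ∈ Ω j, ‖gpar lam x‖ ≤ a₁)
    (hg1 : ∀ j, j ≤ k → ∀ x ∈ Ω j, ∀ μ : Fin d,
      wt L η j * ‖covDerivFwd η U₀ μ (gpar lam) x‖ ≤ b₁ ∧ wt L η j * ‖covDeriv η U₀ μ (gpar lam) x‖ ≤ b₁)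
    (hE0 : Bd2 L η k Ω (Eterm lam) mE)
    (hDA : Bd2 L η k Ω DA cDA)
    (hA : ∀ j, j ≤ k → ∀ x ∈ Ω j, ∀ μ : Fin d,
      wt L η j * ‖A x μ‖ ≤ cA ∧ wt L η j * ‖conjR (U₀ (x - e μ) μ)⁻¹ (A (x - e μ) μ)‖ ≤ cA) :
    Bd2 L η k Ω (PsiP5 η U₀ A DA R gpar Eterm lam) (Mc d BR b₁ cA mE cDA) := by
  have hmW : 0 ≤ mWc d b₁ cA mE cDA := mWc_nonneg hb₁.le hcA hmE hcDA
  have hcV : 0 ≤ 10 * a₁ := by positivity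
  have ha12 : a₁ ≤ 1 / 12 := by linarith
  have hb70 : b₁ ≤ 1 / 70 := by linarith
  have hcA12 : cA ≤ 1 / 12 := by linarith
  have hVsub : ∀ f g : Site d → 𝔸, ∀ j, j ≤ k → ∀ x ∈ Ω j,
      Vop (gpar lam) f x - Vop (gpar lam) g x = Vop (gpar lam) (f - g) x :=
    fun f g j hj x hx => Vop_sub f g ((hg0 j hj x hx).trans ha12)
  have hVbd : ∀ f : Site d → 𝔸, ∀ j, j ≤ k → ∀ x ∈ Ω j, ‖Vop (gpar lam) f x‖ ≤ 10 * a₁ * ‖f x‖ :=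
    fun f j hj x hx => norm_Vop_le f (hg0 j hj x hx) ha12
  have hW : Bd2 L η k Ω (Wsrc η U₀ A DA (gpar lam) (Eterm lam)) (mWc d b₁ cA mE cDA) :=
    fun j hj x hx => wt_sq_norm_Wsrc_le hL hη hb70 hcA hcA12 ((hg0 j hj x hx).trans ha12) (hg1 j hj x hx) (hA j hj x hx)
      (hE0 j hj x hx) (hDA j hj x hx)
  have hZ := bd2_zsol hL hη hVsub hVbd hRsub hRbd hW hcV hBR hmW hθ
  exact hRbd _ _ (by positivity) hZ.neg

/-- **(1.106) for `Ψ = R(−Z_λ)` AT TWO CONFIGURATIONS `λ, λ′`**: `|Ψ(λ) − Ψ(λ′)|₍₋₂₎ ≤ K·δ` from the sizes at `λ`, `λ′` and the moduli `ℓ₀δ`, `ℓ₁δ`,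
`K_Eδ` of `gpar`, `Eterm` between them (`B8Prop5PsiBounds.psiP5_sub_bd2`, hypotheses read at the pair). [cite: Balaban1985RegularSpaces, (1.104)–(1.106) p.94] -/
theorem psiP5_sub_bd2_at (hL : 1 ≤ L) (hη : 0 < η) (R gpar Eterm : (Site d → 𝔸) → (Site d → 𝔸))
    {BR a₁ b₁ cA cDA mE KE ℓ₀ ℓ₁ δ : ℝ} (hδ : 0 ≤ δ)
    (hBR : 0 ≤ BR) (ha₁ : 0 ≤ a₁) (ha₁' : a₁ ≤ 1 / 24) (hb₁ : 0 < b₁) (hb₁' : b₁ ≤ 1 / 140)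
    (hcA : 0 ≤ cA) (hcA' : cA ≤ 1 / 13) (hcDA : 0 ≤ cDA) (hmE : 0 ≤ mE) (hKE : 0 ≤ KE) (hℓ₀ : 0 ≤ ℓ₀) (hℓ₁ : 0 ≤ ℓ₁)
    (hθ : 10 * a₁ * BR ≤ 1 / 2)
    (hRsub : ∀ f g : Site d → 𝔸, R (f - g) = R f - R g)
    (hRbd : ∀ (f : Site d → 𝔸) (m : ℝ), 0 ≤ m → Bd2 L η k Ω f m → Bd2 L η k Ω (R f) (BR * m))
    {lam lam' : Site d → 𝔸} (hg0 : ∀ j, j ≤ k → ∀ x ∈ Ω j, ‖gpar lam x‖ ≤ a₁) (hg0' : ∀ j, j ≤ k → ∀ x ∈ Ω j, ‖gpar lam' x‖ ≤ a₁)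
    (hg1 : ∀ j, j ≤ k → ∀ x ∈ Ω j, ∀ μ : Fin d,
      wt L η j * ‖covDerivFwd η U₀ μ (gpar lam) x‖ ≤ b₁ ∧ wt L η j * ‖covDeriv η U₀ μ (gpar lam) x‖ ≤ b₁)
    (hg1' : ∀ j, j ≤ k → ∀ x ∈ Ω j, ∀ μ : Fin d,
      wt L η j * ‖covDerivFwd η U₀ μ (gpar lam') x‖ ≤ b₁ ∧ wt L η j * ‖covDeriv η U₀ μ (gpar lam') x‖ ≤ b₁)
    (hgL : ∀ j, j ≤ k → ∀ x ∈ Ω j,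
      ‖gpar lam x - gpar lam' x‖ ≤ ℓ₀ * δ ∧ ∀ μ : Fin d,
        wt L η j * ‖covDerivFwd η U₀ μ (gpar lam - gpar lam') x‖ ≤ ℓ₁ * δ ∧
        wt L η j * ‖covDeriv η U₀ μ (gpar lam - gpar lam') x‖ ≤ ℓ₁ * δ)
    (hE0 : Bd2 L η k Ω (Eterm lam) mE) (hE0' : Bd2 L η k Ω (Eterm lam') mE)
    (hEL : Bd2 L η k Ω (Eterm lam - Eterm lam') (KE * δ))
    (hDA : Bd2 L η k Ω DA cDA)
    (hA : ∀ j, j ≤ k → ∀ x ∈ Ω j, ∀ μ : Fin d,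
      wt L η j * ‖A x μ‖ ≤ cA ∧ wt L η j * ‖conjR (U₀ (x - e μ) μ)⁻¹ (A (x - e μ) μ)‖ ≤ cA) :
    Bd2 L η k Ω (PsiP5 η U₀ A DA R gpar Eterm lam - PsiP5 η U₀ A DA R gpar Eterm lam')
      (Kc d BR b₁ cA mE cDA KE ℓ₀ ℓ₁ * δ) := by
  set mW := mWc d b₁ cA mE cDA with hmWdef
  have hmW : 0 ≤ mW := mWc_nonneg hb₁.le hcA hmE hcDA
  have hcV : 0 ≤ 10 * a₁ := by positivity
  have ha12 : a₁ ≤ 1 / 12 := by linarith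
  have hb70 : b₁ ≤ 1 / 70 := by linarith
  have hcA12 : cA ≤ 1 / 12 := by linarith
  have hVsub : ∀ f g : Site d → 𝔸, ∀ j, j ≤ k → ∀ x ∈ Ω j, Vop (gpar lam) f x - Vop (gpar lam) g x = Vop (gpar lam) (f - g) x :=
    fun f g j hj x hx => Vop_sub f g ((hg0 j hj x hx).trans ha12)
  have hVsub' : ∀ f g : Site d → 𝔸, ∀ j, j ≤ k → ∀ x ∈ Ω j, Vop (gpar lam') f x - Vop (gpar lam') g x = Vop (gpar lam') (f - g) x :=
    fun f g j hj x hx => Vop_sub f g ((hg0' j hj x hx).trans ha12)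
  have hVbd : ∀ f : Site d → 𝔸, ∀ j, j ≤ k → ∀ x ∈ Ω j, ‖Vop (gpar lam) f x‖ ≤ 10 * a₁ * ‖f x‖ :=
    fun f j hj x hx => norm_Vop_le f (hg0 j hj x hx) ha12
  have hVbd' : ∀ f : Site d → 𝔸, ∀ j, j ≤ k → ∀ x ∈ Ω j, ‖Vop (gpar lam') f x‖ ≤ 10 * a₁ * ‖f x‖ :=
    fun f j hj x hx => norm_Vop_le f (hg0' j hj x hx) ha12
  have hW : Bd2 L η k Ω (Wsrc η U₀ A DA (gpar lam) (Eterm lam)) mW :=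
    fun j hj x hx => wt_sq_norm_Wsrc_le hL hη hb70 hcA hcA12 ((hg0 j hj x hx).trans ha12) (hg1 j hj x hx) (hA j hj x hx)
      (hE0 j hj x hx) (hDA j hj x hx)
  have hW' : Bd2 L η k Ω (Wsrc η U₀ A DA (gpar lam') (Eterm lam')) mW :=
    fun j hj x hx => wt_sq_norm_Wsrc_le hL hη hb70 hcA hcA12 ((hg0' j hj x hx).trans ha12) (hg1' j hj x hx) (hA j hj x hx)
      (hE0' j hj x hx) (hDA j hj x hx)
  have hKW : 0 ≤ KWc d b₁ cA mE cDA KE ℓ₀ ℓ₁ := KWc_nonneg hb₁.le hcA hmE hcDA hKE hℓ₀ hℓ₁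
  have hdW : Bd2 L η k Ω (Wsrc η U₀ A DA (gpar lam) (Eterm lam) - Wsrc η U₀ A DA (gpar lam') (Eterm lam'))
      (KWc d b₁ cA mE cDA KE ℓ₀ ℓ₁ * δ) := by
    intro j hj x hx
    have h := wt_sq_norm_Wsrc_sub_le (U₀ := U₀) (A := A) (DA := DA) hL hη hb₁ hb₁' hcA hcA' (by positivity : 0 ≤ ℓ₀ * δ)
      ((hg0 j hj x hx).trans ha₁') ((hg0' j hj x hx).trans ha₁') (hg1 j hj x hx) (hg1' j hj x hx) (hA j hj x hx)
      (hE0' j hj x hx) (hDA j hj x hx) (hgL j hj x hx).1 (fun μ => (hgL j hj x hx).2 μ)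
      (by simpa only [Pi.sub_apply] using hEL j hj x hx)
    rw [Pi.sub_apply]
    refine h.trans (le_of_eq ?_)
    unfold KWc; ring
  have hdV : ∀ g : Site d → 𝔸, ∀ j, j ≤ k → ∀ x ∈ Ω j,
      ‖Vop (gpar lam) g x - Vop (gpar lam') g x‖ ≤ 10 * ℓ₀ * δ * ‖g x‖ := by
    intro g j hj x hx
    have h := norm_Vop_sub_Vop_le g ((hg0 j hj x hx).trans ha12) ((hg0' j hj x hx).trans ha12)
    calc ‖Vop (gpar lam) g x - Vop (gpar lam') g x‖ ≤ 10 * ‖g x‖ * ‖gpar lam x - gpar lam' x‖ := h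
      _ ≤ 10 * ‖g x‖ * (ℓ₀ * δ) := by gcongr; exact (hgL j hj x hx).1
      _ = 10 * ℓ₀ * δ * ‖g x‖ := by ring
  have hZZ := bd2_zsol_sub_zsol hL hη hVsub hVbd hVsub' hVbd' hRsub hRbd hW hW' hcV hBR hmW hθ
    (mul_nonneg hKW hδ) (by positivity : 0 ≤ 10 * ℓ₀ * δ) hdW hdV
  have h2c : 0 ≤ 2 * (KWc d b₁ cA mE cDA KE ℓ₀ ℓ₁ * δ + 10 * ℓ₀ * δ * (BR * (2 * mW))) := by positivity
  have hneg := hRbd _ _ h2c hZZ.neg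
  intro j hj x hx
  have h := hneg j hj x hx
  have heq : (PsiP5 η U₀ A DA R gpar Eterm lam - PsiP5 η U₀ A DA R gpar Eterm lam') x =
      R (-(Zsol (Wsrc η U₀ A DA (gpar lam) (Eterm lam)) (Vop (gpar lam)) R -
        Zsol (Wsrc η U₀ A DA (gpar lam') (Eterm lam')) (Vop (gpar lam')) R)) x := by
    simp only [PsiP5, Pi.sub_apply]
    rw [← Pi.sub_apply (R _) (R _), ← hRsub]
    congr 1
    funext y; simp only [Pi.sub_apply, Pi.neg_apply]; abel
  rw [heq]
  refine h.trans (le_of_eq ?_)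
  unfold Kc; ring

/-- **PROPOSITION 5's FIXED POINT OF (1.100) AT `k` LEVELS ON THE `P`-PERIODIC CONFIGURATIONS** — `B8Prop5ContractionKLevel.propFive_fixedPoint_kLevel`
VERBATIM with `hg0`, `hg1`, `hgL`, `hE0`, `hEL` at PERIODIC `λ_s`, `λ_t` only and `G′` periodic-valued (`hGper`): exactly one `P`-periodic `s` in the
¼α₄-ball with `λ_s = G′(Ψλ_s)`. [cite: Balaban1985RegularSpaces, p.94 (after (1.106)), (1.100)–(1.103) p.93, (1.96)–(1.99) pp.92–93, p.77 («Ω_j = T_η»)] -/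
theorem propFive_fixedPoint_kLevel_per (hL : 1 ≤ L) (hη : 0 < η) (P : ℤ)
    (Gp R gpar Eterm : (Site d → 𝔸) → (Site d → 𝔸))
    {α₄ BG BR a₁ b₁ cA cDA mE KE ℓ₀ ℓ₁ : ℝ}
    (hα₄ : 0 ≤ α₄) (hBG : 0 ≤ BG) (hBR : 0 ≤ BR) (ha₁ : 0 ≤ a₁) (ha₁' : a₁ ≤ 1 / 24) (hb₁ : 0 < b₁) (hb₁' : b₁ ≤ 1 / 140)
    (hcA : 0 ≤ cA) (hcA' : cA ≤ 1 / 13) (hcDA : 0 ≤ cDA) (hmE : 0 ≤ mE) (hKE : 0 ≤ KE) (hℓ₀ : 0 ≤ ℓ₀) (hℓ₁ : 0 ≤ ℓ₁)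
    (hθ : 10 * a₁ * BR ≤ 1 / 2)
    (hG : ∀ (f : Site d → 𝔸) (m : ℝ), 0 ≤ m → Bd2 L η k Ω f m →
      (∀ x, ‖Gp f x‖ ≤ BG * m) ∧ ∀ j, j ≤ k → ∀ p ∈ Eb j, wt L η j * ‖covDerivFwd η U₀ p.2 (Gp f) p.1‖ ≤ BG * m)
    (hGsub : ∀ f g : Site d → 𝔸, Gp (f - g) = Gp f - Gp g)
    (hGper : ∀ (f : Site d → 𝔸) (z : Site d) (i : Fin d), Gp f (z + P • e i) = Gp f z)
    (hRsub : ∀ f g : Site d → 𝔸, R (f - g) = R f - R g)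
    (hRbd : ∀ (f : Site d → 𝔸) (m : ℝ), 0 ≤ m → Bd2 L η k Ω f m → Bd2 L η k Ω (R f) (BR * m))
    (hg0 : ∀ s : lamSubK η U₀ L k Eb, (∀ (z : Site d) (i : Fin d), lamOf s (z + P • e i) = lamOf s z) → ‖s‖ ≤ α₄ / 4 →
      ∀ j, j ≤ k → ∀ x ∈ Ω j, ‖gpar (lamOf s) x‖ ≤ a₁)
    (hg1 : ∀ s : lamSubK η U₀ L k Eb, (∀ (z : Site d) (i : Fin d), lamOf s (z + P • e i) = lamOf s z) → ‖s‖ ≤ α₄ / 4 →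
      ∀ j, j ≤ k → ∀ x ∈ Ω j, ∀ μ : Fin d,
      wt L η j * ‖covDerivFwd η U₀ μ (gpar (lamOf s)) x‖ ≤ b₁ ∧ wt L η j * ‖covDeriv η U₀ μ (gpar (lamOf s)) x‖ ≤ b₁)
    (hgL : ∀ s t : lamSubK η U₀ L k Eb, (∀ (z : Site d) (i : Fin d), lamOf s (z + P • e i) = lamOf s z) → (∀ (z : Site d) (i : Fin d), lamOf t (z + P • e i) = lamOf t z) →
      ‖s‖ ≤ α₄ / 4 → ‖t‖ ≤ α₄ / 4 → ∀ j, j ≤ k → ∀ x ∈ Ω j,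
      ‖gpar (lamOf s) x - gpar (lamOf t) x‖ ≤ ℓ₀ * ‖s - t‖ ∧ ∀ μ : Fin d,
        wt L η j * ‖covDerivFwd η U₀ μ (gpar (lamOf s) - gpar (lamOf t)) x‖ ≤ ℓ₁ * ‖s - t‖ ∧
        wt L η j * ‖covDeriv η U₀ μ (gpar (lamOf s) - gpar (lamOf t)) x‖ ≤ ℓ₁ * ‖s - t‖)
    (hE0 : ∀ s : lamSubK η U₀ L k Eb, (∀ (z : Site d) (i : Fin d), lamOf s (z + P • e i) = lamOf s z) → ‖s‖ ≤ α₄ / 4 →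
      Bd2 L η k Ω (Eterm (lamOf s)) mE)
    (hEL : ∀ s t : lamSubK η U₀ L k Eb, (∀ (z : Site d) (i : Fin d), lamOf s (z + P • e i) = lamOf s z) → (∀ (z : Site d) (i : Fin d), lamOf t (z + P • e i) = lamOf t z) →
      ‖s‖ ≤ α₄ / 4 → ‖t‖ ≤ α₄ / 4 → Bd2 L η k Ω (Eterm (lamOf s) - Eterm (lamOf t)) (KE * ‖s - t‖))
    (hDA : Bd2 L η k Ω DA cDA)
    (hA : ∀ j, j ≤ k → ∀ x ∈ Ω j, ∀ μ : Fin d,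
      wt L η j * ‖A x μ‖ ≤ cA ∧ wt L η j * ‖conjR (U₀ (x - e μ) μ)⁻¹ (A (x - e μ) μ)‖ ≤ cA)
    (h103 : BG * Mc d BR b₁ cA mE cDA ≤ α₄ / 4) (h106 : BG * Kc d BR b₁ cA mE cDA KE ℓ₀ ℓ₁ ≤ 1 / 2) :
    ∃ s : lamSubK η U₀ L k Eb, (∀ (z : Site d) (i : Fin d), lamOf s (z + P • e i) = lamOf s z) ∧ ‖s‖ ≤ α₄ / 4 ∧
      lamOf s = Gp (PsiP5 η U₀ A DA R gpar Eterm (lamOf s)) ∧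
      ∀ t : lamSubK η U₀ L k Eb, (∀ (z : Site d) (i : Fin d), lamOf t (z + P • e i) = lamOf t z) → ‖t‖ ≤ α₄ / 4 →
        lamOf t = Gp (PsiP5 η U₀ A DA R gpar Eterm (lamOf t)) → t = s := by
  have hmW : 0 ≤ mWc d b₁ cA mE cDA := mWc_nonneg hb₁.le hcA hmE hcDA
  have hKW : 0 ≤ KWc d b₁ cA mE cDA KE ℓ₀ ℓ₁ := KWc_nonneg hb₁.le hcA hmE hcDA hKE hℓ₀ hℓ₁
  have hM0 : 0 ≤ Mc d BR b₁ cA mE cDA := by unfold Mc; positivity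
  have hK0 : 0 ≤ Kc d BR b₁ cA mE cDA KE ℓ₀ ℓ₁ := by unfold Kc; positivity
  have hΨ0 : ∀ s : lamSubK η U₀ L k Eb, (∀ (z : Site d) (i : Fin d), lamOf s (z + P • e i) = lamOf s z) → ‖s‖ ≤ α₄ / 4 →
      ∀ j, j ≤ k → ∀ x ∈ Ω j, wt L η j ^ 2 * ‖PsiP5 η U₀ A DA R gpar Eterm (lamOf s) x‖ ≤ Mc d BR b₁ cA mE cDA :=
    fun s hp hs => psiP5_bd2_at (Ω := Ω) hL hη R gpar Eterm hBR ha₁ ha₁' hb₁ hb₁' hcA hcA' hcDA hmE hθ hRsub hRbd (hg0 s hp hs) (hg1 s hp hs)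
      (hE0 s hp hs) hDA hA
  have hΨ1 : ∀ s t : lamSubK η U₀ L k Eb, (∀ (z : Site d) (i : Fin d), lamOf s (z + P • e i) = lamOf s z) →
      (∀ (z : Site d) (i : Fin d), lamOf t (z + P • e i) = lamOf t z) → ‖s‖ ≤ α₄ / 4 → ‖t‖ ≤ α₄ / 4 → ∀ j, j ≤ k → ∀ x ∈ Ω j,
      wt L η j ^ 2 * ‖PsiP5 η U₀ A DA R gpar Eterm (lamOf s) x - PsiP5 η U₀ A DA R gpar Eterm (lamOf t) x‖ ≤
        Kc d BR b₁ cA mE cDA KE ℓ₀ ℓ₁ * ‖s - t‖ := fun s t hps hpt hs ht j hj x hx => by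
    simpa only [Pi.sub_apply] using psiP5_sub_bd2_at (Ω := Ω) hL hη R gpar Eterm (norm_nonneg (s - t)) hBR ha₁ ha₁' hb₁ hb₁' hcA hcA'
      hcDA hmE hKE hℓ₀ hℓ₁ hθ hRsub hRbd (hg0 s hps hs) (hg0 t hpt ht) (hg1 s hps hs) (hg1 t hpt ht) (hgL s t hps hpt hs ht) (hE0 s hps hs)
      (hE0 t hpt ht) (hEL s t hps hpt hs ht) hDA hA j hj x hx
  exact fixedPoint_kLevel_per hη.le Ω P Gp (PsiP5 η U₀ A DA R gpar Eterm) hα₄ hBG hM0 hK0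
    (fun f m hm hf => hG f m hm hf) hGsub hGper hΨ0 hΨ1 h103 h106

/-- **WHAT THE PERIODIC FIXED POINT CARRIES** — `B8Prop5ContractionKLevel.propFive_fixedPoint_kLevel_spec` VERBATIM with `hg0`, `hg1`, `hE0` at periodic
`λ` only and the given `s` periodic: the Neumann identity `Z + V_{λ′}(RZ) = W`, `|Z|₍₋₂₎ ≤ 2m_W`, `‖s‖ ≤ B_G·M` ((1.108)), `λ_s = 0` off `Ω₀`.
[cite: Balaban1985RegularSpaces, (1.95)–(1.96) p.92, (1.108) p.94; Balaban1985BackgroundPropagators, (3.24) p.394] -/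
theorem propFive_fixedPoint_kLevel_spec_per (hL : 1 ≤ L) (hη : 0 < η) (P : ℤ)
    (Gp R gpar Eterm : (Site d → 𝔸) → (Site d → 𝔸))
    {α₄ BG BR a₁ b₁ cA cDA mE : ℝ}
    (hBR : 0 ≤ BR) (ha₁ : 0 ≤ a₁) (ha₁' : a₁ ≤ 1 / 24) (hb₁ : 0 < b₁) (hb₁' : b₁ ≤ 1 / 140)
    (hcA : 0 ≤ cA) (hcA' : cA ≤ 1 / 13) (hcDA : 0 ≤ cDA) (hmE : 0 ≤ mE) (hθ : 10 * a₁ * BR ≤ 1 / 2)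
    (hG : ∀ (f : Site d → 𝔸) (m : ℝ), 0 ≤ m → Bd2 L η k Ω f m →
      (∀ x, ‖Gp f x‖ ≤ BG * m) ∧ ∀ j, j ≤ k → ∀ p ∈ Eb j, wt L η j * ‖covDerivFwd η U₀ p.2 (Gp f) p.1‖ ≤ BG * m)
    (hGsupp : ∀ (f : Site d → 𝔸) (x : Site d), x ∉ Ω 0 → Gp f x = 0)
    (hRsub : ∀ f g : Site d → 𝔸, R (f - g) = R f - R g)
    (hRbd : ∀ (f : Site d → 𝔸) (m : ℝ), 0 ≤ m → Bd2 L η k Ω f m → Bd2 L η k Ω (R f) (BR * m))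
    (hg0 : ∀ s : lamSubK η U₀ L k Eb, (∀ (z : Site d) (i : Fin d), lamOf s (z + P • e i) = lamOf s z) → ‖s‖ ≤ α₄ / 4 → ∀ j, j ≤ k → ∀ x ∈ Ω j, ‖gpar (lamOf s) x‖ ≤ a₁)
    (hg1 : ∀ s : lamSubK η U₀ L k Eb, (∀ (z : Site d) (i : Fin d), lamOf s (z + P • e i) = lamOf s z) → ‖s‖ ≤ α₄ / 4 → ∀ j, j ≤ k → ∀ x ∈ Ω j, ∀ μ : Fin d,
      wt L η j * ‖covDerivFwd η U₀ μ (gpar (lamOf s)) x‖ ≤ b₁ ∧ wt L η j * ‖covDeriv η U₀ μ (gpar (lamOf s)) x‖ ≤ b₁)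
    (hE0 : ∀ s : lamSubK η U₀ L k Eb, (∀ (z : Site d) (i : Fin d), lamOf s (z + P • e i) = lamOf s z) → ‖s‖ ≤ α₄ / 4 → Bd2 L η k Ω (Eterm (lamOf s)) mE)
    (hDA : Bd2 L η k Ω DA cDA)
    (hA : ∀ j, j ≤ k → ∀ x ∈ Ω j, ∀ μ : Fin d,
      wt L η j * ‖A x μ‖ ≤ cA ∧ wt L η j * ‖conjR (U₀ (x - e μ) μ)⁻¹ (A (x - e μ) μ)‖ ≤ cA)
    {s : lamSubK η U₀ L k Eb} (hp : (∀ (z : Site d) (i : Fin d), lamOf s (z + P • e i) = lamOf s z)) (hs : ‖s‖ ≤ α₄ / 4)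
    (hfix : lamOf s = Gp (PsiP5 η U₀ A DA R gpar Eterm (lamOf s))) :
    (∀ j, j ≤ k → ∀ x ∈ Ω j,
      Zsol (Wsrc η U₀ A DA (gpar (lamOf s)) (Eterm (lamOf s))) (Vop (gpar (lamOf s))) R x +
        Vop (gpar (lamOf s)) (R (Zsol (Wsrc η U₀ A DA (gpar (lamOf s)) (Eterm (lamOf s))) (Vop (gpar (lamOf s))) R)) x =
      Wsrc η U₀ A DA (gpar (lamOf s)) (Eterm (lamOf s)) x) ∧
    Bd2 L η k Ω (Zsol (Wsrc η U₀ A DA (gpar (lamOf s)) (Eterm (lamOf s))) (Vop (gpar (lamOf s))) R) (2 * mWc d b₁ cA mE cDA) ∧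
    ‖s‖ ≤ BG * Mc d BR b₁ cA mE cDA ∧
    (∀ x, x ∉ Ω 0 → lamOf s x = 0) := by
  set mW := mWc d b₁ cA mE cDA with hmWdef
  have hmW : 0 ≤ mW := mWc_nonneg hb₁.le hcA hmE hcDA
  have hcV : 0 ≤ 10 * a₁ := by positivity
  have ha12 : a₁ ≤ 1 / 12 := by linarith
  have hb70 : b₁ ≤ 1 / 70 := by linarith
  have hcA12 : cA ≤ 1 / 12 := by linarith
  have hVsub : ∀ f g : Site d → 𝔸, ∀ j, j ≤ k → ∀ x ∈ Ω j,
      Vop (gpar (lamOf s)) f x - Vop (gpar (lamOf s)) g x = Vop (gpar (lamOf s)) (f - g) x :=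
    fun f g j hj x hx => Vop_sub f g ((hg0 s hp hs j hj x hx).trans ha12)
  have hVbd : ∀ f : Site d → 𝔸, ∀ j, j ≤ k → ∀ x ∈ Ω j, ‖Vop (gpar (lamOf s)) f x‖ ≤ 10 * a₁ * ‖f x‖ :=
    fun f j hj x hx => norm_Vop_le f (hg0 s hp hs j hj x hx) ha12
  have hW : Bd2 L η k Ω (Wsrc η U₀ A DA (gpar (lamOf s)) (Eterm (lamOf s))) mW :=
    fun j hj x hx => wt_sq_norm_Wsrc_le hL hη hb70 hcA hcA12 ((hg0 s hp hs j hj x hx).trans ha12) (hg1 s hp hs j hj x hx) (hA j hj x hx)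
      (hE0 s hp hs j hj x hx) (hDA j hj x hx)
  have hZ := bd2_zsol hL hη hVsub hVbd hRsub hRbd hW hcV hBR hmW hθ
  refine ⟨fun j hj x hx => zsol_eq hL hη hVsub hVbd hRsub hRbd hW hcV hBR hmW hθ hj hx, hZ, ?_, ?_⟩
  · -- ‖s‖ ≤ B_G·M from the fixed-point equation and the letter bound
    have hΨ : Bd2 L η k Ω (PsiP5 η U₀ A DA R gpar Eterm (lamOf s)) (Mc d BR b₁ cA mE cDA) :=
      hRbd _ _ (by positivity) hZ.neg
    have hB : 0 ≤ BG * Mc d BR b₁ cA mE cDA := by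
      obtain ⟨h0, -⟩ := hG _ _ (by unfold Mc; positivity) hΨ
      exact (norm_nonneg _).trans (h0 0)
    refine (norm_le_iff hη.le s hB).2 ⟨fun x => ?_, fun j hj p hp => ?_⟩
    · rw [hfix]; exact (hG _ _ (by unfold Mc; positivity) hΨ).1 x
    · rw [hfix]; exact (hG _ _ (by unfold Mc; positivity) hΨ).2 j hj p hp
  · intro x hx
    rw [hfix]; exact hGsupp _ x hx

end General

/-! ## §2 Reality and `τ`-freeness of the periodic fixed point -/

section CStar

variable {𝔸 : Type*} [CStarAlgebra 𝔸] [Nontrivial 𝔸]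
variable (τ : 𝔸 →L[ℂ] ℂ)
variable {L k : ℕ} {η : ℝ} {Ω : ℕ → Set (Site d)} {Eb : ℕ → Set (Site d × Fin d)} {U₀ : Site d → Fin d → 𝔸ˣ}
  {A : Site d → Fin d → 𝔸} {DA : Site d → 𝔸}

/-- **`G′(Ψλ)` is Hermitian for Hermitian data, AT ONE `λ`** — the invariance step of `B8Prop5Reality.propFive_fixedPoint_kLevel_selfAdjoint` with its
hypotheses read at the one configuration `λ` (sizes of `λ′ = gpar λ`, `Eterm λ`; reality of `λ′`, `Eterm λ`, `A`, `D*A`; `R`, `G′` reality).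
[cite: Balaban1985RegularSpaces, p.93 (after (1.102)), (1.100) p.93] -/
theorem psiP5_real_at (hL : 1 ≤ L) (hη : 0 < η) (hU₀ : ∀ x κ, U₀ x κ ∈ unitaryUnits 𝔸) (Gp R gpar Eterm : (Site d → 𝔸) → (Site d → 𝔸))
    {BR a₁ b₁ cA cDA mE : ℝ} (hBR : 0 ≤ BR) (ha₁ : 0 ≤ a₁) (ha₁' : a₁ ≤ 1 / 24) (hb₁ : 0 < b₁) (hb₁' : b₁ ≤ 1 / 140)
    (hcA : 0 ≤ cA) (hcA' : cA ≤ 1 / 13) (hcDA : 0 ≤ cDA) (hmE : 0 ≤ mE) (hθ : 10 * a₁ * BR ≤ 1 / 2)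
    (hRsub : ∀ f g : Site d → 𝔸, R (f - g) = R f - R g)
    (hRbd : ∀ (f : Site d → 𝔸) (m : ℝ), 0 ≤ m → Bd2 L η k Ω f m → Bd2 L η k Ω (R f) (BR * m))
    (hRreal : ∀ f : Site d → 𝔸, (∀ j, j ≤ k → ∀ x ∈ Ω j, IsSelfAdjoint (f x)) → ∀ j, j ≤ k → ∀ x ∈ Ω j, IsSelfAdjoint (R f x))
    (hGreal : ∀ f : Site d → 𝔸, (∀ j, j ≤ k → ∀ x ∈ Ω j, IsSelfAdjoint (f x)) → ∀ x, IsSelfAdjoint (Gp f x))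
    {lam : Site d → 𝔸} (hg0 : ∀ j, j ≤ k → ∀ x ∈ Ω j, ‖gpar lam x‖ ≤ a₁)
    (hg1 : ∀ j, j ≤ k → ∀ x ∈ Ω j, ∀ μ : Fin d,
      wt L η j * ‖covDerivFwd η U₀ μ (gpar lam) x‖ ≤ b₁ ∧ wt L η j * ‖covDeriv η U₀ μ (gpar lam) x‖ ≤ b₁)
    (hE0 : Bd2 L η k Ω (Eterm lam) mE) (hDA : Bd2 L η k Ω DA cDA)
    (hA : ∀ j, j ≤ k → ∀ x ∈ Ω j, ∀ μ : Fin d,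
      wt L η j * ‖A x μ‖ ≤ cA ∧ wt L η j * ‖conjR (U₀ (x - e μ) μ)⁻¹ (A (x - e μ) μ)‖ ≤ cA)
    (hAsa : ∀ x μ, IsSelfAdjoint (A x μ)) (hDAsa : ∀ j, j ≤ k → ∀ x ∈ Ω j, IsSelfAdjoint (DA x))
    (hasa : ∀ y, IsSelfAdjoint (gpar lam y)) (hEsa : ∀ j, j ≤ k → ∀ x ∈ Ω j, IsSelfAdjoint (Eterm lam x)) :
    ∀ x, IsSelfAdjoint (Gp (PsiP5 η U₀ A DA R gpar Eterm lam) x) := by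
  have hmW : 0 ≤ mWc d b₁ cA mE cDA := mWc_nonneg hb₁.le hcA hmE hcDA
  have hcV : 0 ≤ 10 * a₁ := by positivity
  have ha12 : a₁ ≤ 1 / 12 := by linarith
  have hb70 : b₁ ≤ 1 / 70 := by linarith
  have hcA12 : cA ≤ 1 / 12 := by linarith
  have hVsub : ∀ f g : Site d → 𝔸, ∀ j, j ≤ k → ∀ x ∈ Ω j,
      Vop (gpar lam) f x - Vop (gpar lam) g x = Vop (gpar lam) (f - g) x :=
    fun f g j hj x hx => Vop_sub f g ((hg0 j hj x hx).trans ha12)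
  have hVbd : ∀ f : Site d → 𝔸, ∀ j, j ≤ k → ∀ x ∈ Ω j, ‖Vop (gpar lam) f x‖ ≤ 10 * a₁ * ‖f x‖ :=
    fun f j hj x hx => norm_Vop_le f (hg0 j hj x hx) ha12
  have hW : Bd2 L η k Ω (Wsrc η U₀ A DA (gpar lam) (Eterm lam)) (mWc d b₁ cA mE cDA) :=
    fun j hj x hx => wt_sq_norm_Wsrc_le hL hη hb70 hcA hcA12 ((hg0 j hj x hx).trans ha12) (hg1 j hj x hx) (hA j hj x hx)
      (hE0 j hj x hx) (hDA j hj x hx)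
  have hWsa : ∀ j, j ≤ k → ∀ x ∈ Ω j, IsSelfAdjoint (Wsrc η U₀ A DA (gpar lam) (Eterm lam) x) :=
    fun j hj x hx => isSelfAdjoint_Wsrc hL hη hU₀ hb₁' hcA' hasa (hEsa j hj x hx) (hDAsa j hj x hx) hAsa
      ((hg0 j hj x hx).trans ha₁') (hg1 j hj x hx) (hA j hj x hx)
  have hVsa : ∀ f : Site d → 𝔸, ∀ j, j ≤ k → ∀ x ∈ Ω j, IsSelfAdjoint (f x) → IsSelfAdjoint (Vop (gpar lam) f x) :=
    fun f j hj x hx hf => isSelfAdjoint_Vop (hasa x) ((hg0 j hj x hx).trans ha12) hf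
  have hZsa : ∀ j, j ≤ k → ∀ x ∈ Ω j,
      IsSelfAdjoint (Zsol (Wsrc η U₀ A DA (gpar lam) (Eterm lam)) (Vop (gpar lam)) R x) :=
    fun j hj x hx => isSelfAdjoint_zsol hL hη hVsub hVbd hRsub hRbd hW hcV hBR hmW hθ hWsa hVsa hRreal hj hx
  refine hGreal _ (hRreal _ fun j hj x hx => ?_)
  exact (hZsa j hj x hx).neg

/-- **THE PERIODIC FIXED POINT IS A REAL CONFIGURATION** — `B8Prop5Reality.propFive_fixedPoint_kLevel_selfAdjoint` VERBATIM with the Sect.-E data and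
their reality at periodic `λ` only (`B8LambdaSpaceKLevelOn.fixedPoint_kLevel_per_selfAdjoint` + `psiP5_real_at`).
[cite: Balaban1985RegularSpaces, p.93 (after (1.102)), (1.100) p.93, (1.107) p.94] -/
theorem propFive_fixedPoint_kLevel_selfAdjoint_per (hL : 1 ≤ L) (hη : 0 < η) (hU₀ : ∀ x κ, U₀ x κ ∈ unitaryUnits 𝔸) (P : ℤ)
    (Gp R gpar Eterm : (Site d → 𝔸) → (Site d → 𝔸))
    {α₄ BG BR a₁ b₁ cA cDA mE KE ℓ₀ ℓ₁ : ℝ}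
    (hα₄ : 0 ≤ α₄) (hBG : 0 ≤ BG) (hBR : 0 ≤ BR) (ha₁ : 0 ≤ a₁) (ha₁' : a₁ ≤ 1 / 24) (hb₁ : 0 < b₁) (hb₁' : b₁ ≤ 1 / 140)
    (hcA : 0 ≤ cA) (hcA' : cA ≤ 1 / 13) (hcDA : 0 ≤ cDA) (hmE : 0 ≤ mE) (hKE : 0 ≤ KE) (hℓ₀ : 0 ≤ ℓ₀) (hℓ₁ : 0 ≤ ℓ₁)
    (hθ : 10 * a₁ * BR ≤ 1 / 2)
    (hG : ∀ (f : Site d → 𝔸) (m : ℝ), 0 ≤ m → Bd2 L η k Ω f m →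
      (∀ x, ‖Gp f x‖ ≤ BG * m) ∧ ∀ j, j ≤ k → ∀ p ∈ Eb j, wt L η j * ‖covDerivFwd η U₀ p.2 (Gp f) p.1‖ ≤ BG * m)
    (hGsub : ∀ f g : Site d → 𝔸, Gp (f - g) = Gp f - Gp g)
    (hGper : ∀ (f : Site d → 𝔸) (z : Site d) (i : Fin d), Gp f (z + P • e i) = Gp f z)
    (hRsub : ∀ f g : Site d → 𝔸, R (f - g) = R f - R g)
    (hRbd : ∀ (f : Site d → 𝔸) (m : ℝ), 0 ≤ m → Bd2 L η k Ω f m → Bd2 L η k Ω (R f) (BR * m))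
    (hg0 : ∀ s : lamSubK η U₀ L k Eb, (∀ (z : Site d) (i : Fin d), lamOf s (z + P • e i) = lamOf s z) → ‖s‖ ≤ α₄ / 4 →
      ∀ j, j ≤ k → ∀ x ∈ Ω j, ‖gpar (lamOf s) x‖ ≤ a₁)
    (hg1 : ∀ s : lamSubK η U₀ L k Eb, (∀ (z : Site d) (i : Fin d), lamOf s (z + P • e i) = lamOf s z) → ‖s‖ ≤ α₄ / 4 →
      ∀ j, j ≤ k → ∀ x ∈ Ω j, ∀ μ : Fin d,
      wt L η j * ‖covDerivFwd η U₀ μ (gpar (lamOf s)) x‖ ≤ b₁ ∧ wt L η j * ‖covDeriv η U₀ μ (gpar (lamOf s)) x‖ ≤ b₁)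
    (hgL : ∀ s t : lamSubK η U₀ L k Eb, (∀ (z : Site d) (i : Fin d), lamOf s (z + P • e i) = lamOf s z) → (∀ (z : Site d) (i : Fin d), lamOf t (z + P • e i) = lamOf t z) →
      ‖s‖ ≤ α₄ / 4 → ‖t‖ ≤ α₄ / 4 → ∀ j, j ≤ k → ∀ x ∈ Ω j,
      ‖gpar (lamOf s) x - gpar (lamOf t) x‖ ≤ ℓ₀ * ‖s - t‖ ∧ ∀ μ : Fin d,
        wt L η j * ‖covDerivFwd η U₀ μ (gpar (lamOf s) - gpar (lamOf t)) x‖ ≤ ℓ₁ * ‖s - t‖ ∧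
        wt L η j * ‖covDeriv η U₀ μ (gpar (lamOf s) - gpar (lamOf t)) x‖ ≤ ℓ₁ * ‖s - t‖)
    (hE0 : ∀ s : lamSubK η U₀ L k Eb, (∀ (z : Site d) (i : Fin d), lamOf s (z + P • e i) = lamOf s z) → ‖s‖ ≤ α₄ / 4 →
      Bd2 L η k Ω (Eterm (lamOf s)) mE)
    (hEL : ∀ s t : lamSubK η U₀ L k Eb, (∀ (z : Site d) (i : Fin d), lamOf s (z + P • e i) = lamOf s z) → (∀ (z : Site d) (i : Fin d), lamOf t (z + P • e i) = lamOf t z) →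
      ‖s‖ ≤ α₄ / 4 → ‖t‖ ≤ α₄ / 4 → Bd2 L η k Ω (Eterm (lamOf s) - Eterm (lamOf t)) (KE * ‖s - t‖))
    (hDA : Bd2 L η k Ω DA cDA)
    (hA : ∀ j, j ≤ k → ∀ x ∈ Ω j, ∀ μ : Fin d,
      wt L η j * ‖A x μ‖ ≤ cA ∧ wt L η j * ‖conjR (U₀ (x - e μ) μ)⁻¹ (A (x - e μ) μ)‖ ≤ cA)
    (h103 : BG * Mc d BR b₁ cA mE cDA ≤ α₄ / 4) (h106 : BG * Kc d BR b₁ cA mE cDA KE ℓ₀ ℓ₁ ≤ 1 / 2)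
    -- reality of the data
    (hAsa : ∀ x μ, IsSelfAdjoint (A x μ)) (hDAsa : ∀ j, j ≤ k → ∀ x ∈ Ω j, IsSelfAdjoint (DA x))
    (hgsa : ∀ s : lamSubK η U₀ L k Eb, (∀ (z : Site d) (i : Fin d), lamOf s (z + P • e i) = lamOf s z) → ‖s‖ ≤ α₄ / 4 →
      (∀ x, IsSelfAdjoint (lamOf s x)) → ∀ x, IsSelfAdjoint (gpar (lamOf s) x))
    (hEsa : ∀ s : lamSubK η U₀ L k Eb, (∀ (z : Site d) (i : Fin d), lamOf s (z + P • e i) = lamOf s z) → ‖s‖ ≤ α₄ / 4 →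
      (∀ x, IsSelfAdjoint (lamOf s x)) → ∀ j, j ≤ k → ∀ x ∈ Ω j, IsSelfAdjoint (Eterm (lamOf s) x))
    (hRreal : ∀ f : Site d → 𝔸, (∀ j, j ≤ k → ∀ x ∈ Ω j, IsSelfAdjoint (f x)) → ∀ j, j ≤ k → ∀ x ∈ Ω j, IsSelfAdjoint (R f x))
    (hGreal : ∀ f : Site d → 𝔸, (∀ j, j ≤ k → ∀ x ∈ Ω j, IsSelfAdjoint (f x)) → ∀ x, IsSelfAdjoint (Gp f x))
    {s : lamSubK η U₀ L k Eb} (hp : (∀ (z : Site d) (i : Fin d), lamOf s (z + P • e i) = lamOf s z)) (hs : ‖s‖ ≤ α₄ / 4)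
    (hfix : lamOf s = Gp (PsiP5 η U₀ A DA R gpar Eterm (lamOf s))) :
    ∀ x, IsSelfAdjoint (lamOf s x) := by
  have hmW : 0 ≤ mWc d b₁ cA mE cDA := mWc_nonneg hb₁.le hcA hmE hcDA
  have hKW : 0 ≤ KWc d b₁ cA mE cDA KE ℓ₀ ℓ₁ := KWc_nonneg hb₁.le hcA hmE hcDA hKE hℓ₀ hℓ₁
  have hM0 : 0 ≤ Mc d BR b₁ cA mE cDA := by unfold Mc; positivity
  have hK0 : 0 ≤ Kc d BR b₁ cA mE cDA KE ℓ₀ ℓ₁ := by unfold Kc; positivity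
  have hΨ0 : ∀ s : lamSubK η U₀ L k Eb, (∀ (z : Site d) (i : Fin d), lamOf s (z + P • e i) = lamOf s z) → ‖s‖ ≤ α₄ / 4 →
      ∀ j, j ≤ k → ∀ x ∈ Ω j, wt L η j ^ 2 * ‖PsiP5 η U₀ A DA R gpar Eterm (lamOf s) x‖ ≤ Mc d BR b₁ cA mE cDA :=
    fun s hp hs => psiP5_bd2_at (Ω := Ω) hL hη R gpar Eterm hBR ha₁ ha₁' hb₁ hb₁' hcA hcA' hcDA hmE hθ hRsub hRbd (hg0 s hp hs) (hg1 s hp hs)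
      (hE0 s hp hs) hDA hA
  have hΨ1 : ∀ s t : lamSubK η U₀ L k Eb, (∀ (z : Site d) (i : Fin d), lamOf s (z + P • e i) = lamOf s z) →
      (∀ (z : Site d) (i : Fin d), lamOf t (z + P • e i) = lamOf t z) → ‖s‖ ≤ α₄ / 4 → ‖t‖ ≤ α₄ / 4 → ∀ j, j ≤ k → ∀ x ∈ Ω j,
      wt L η j ^ 2 * ‖PsiP5 η U₀ A DA R gpar Eterm (lamOf s) x - PsiP5 η U₀ A DA R gpar Eterm (lamOf t) x‖ ≤
        Kc d BR b₁ cA mE cDA KE ℓ₀ ℓ₁ * ‖s - t‖ := fun s t hps hpt hs ht j hj x hx => by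
    simpa only [Pi.sub_apply] using psiP5_sub_bd2_at (Ω := Ω) hL hη R gpar Eterm (norm_nonneg (s - t)) hBR ha₁ ha₁' hb₁ hb₁' hcA hcA'
      hcDA hmE hKE hℓ₀ hℓ₁ hθ hRsub hRbd (hg0 s hps hs) (hg0 t hpt ht) (hg1 s hps hs) (hg1 t hpt ht) (hgL s t hps hpt hs ht) (hE0 s hps hs)
      (hE0 t hpt ht) (hEL s t hps hpt hs ht) hDA hA j hj x hx
  exact fixedPoint_kLevel_per_selfAdjoint hη.le Ω P Gp (PsiP5 η U₀ A DA R gpar Eterm) hα₄ hBG hM0 hK0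
    (fun f m hm hf => hG f m hm hf) hGsub hGper hΨ0 hΨ1 h103 h106
    (fun t hpt ht hsa => psiP5_real_at (Ω := Ω) hL hη hU₀ Gp R gpar Eterm hBR ha₁ ha₁' hb₁ hb₁' hcA hcA' hcDA hmE hθ hRsub hRbd hRreal hGreal
      (hg0 t hpt ht) (hg1 t hpt ht) (hE0 t hpt ht) hDA hA hAsa hDAsa (hgsa t hpt ht hsa) (hEsa t hpt ht hsa))
    hp hs hfix

/-- **`G′(Ψλ)` is `τ`-free for `τ`-free data, AT ONE `λ`** — the invariance step of `B8Prop5TraceFree.propFive_fixedPoint_kLevel_traceFree` with its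
hypotheses read at the one configuration `λ`. [cite: Balaban1985RegularSpaces, (1.17) p.78, p.93 (after (1.102)), (1.100) p.93] -/
theorem psiP5_traceFree_at (hτ : ∀ x y : 𝔸, τ (x * y) = τ (y * x))
    (hlog : ∀ a b : 𝔸, ‖a‖ + ‖b‖ ≤ 1 / 2 → τ (mlog (exp a * exp b)) = τ a + τ b)
    (hL : 1 ≤ L) (hη : 0 < η) (Gp R gpar Eterm : (Site d → 𝔸) → (Site d → 𝔸))
    {BR a₁ b₁ cA cDA mE : ℝ} (hBR : 0 ≤ BR) (ha₁ : 0 ≤ a₁) (ha₁' : a₁ ≤ 1 / 24) (hb₁ : 0 < b₁) (hb₁' : b₁ ≤ 1 / 140)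
    (hcA : 0 ≤ cA) (hcA' : cA ≤ 1 / 13) (hcDA : 0 ≤ cDA) (hmE : 0 ≤ mE) (hθ : 10 * a₁ * BR ≤ 1 / 2)
    (hRsub : ∀ f g : Site d → 𝔸, R (f - g) = R f - R g)
    (hRbd : ∀ (f : Site d → 𝔸) (m : ℝ), 0 ≤ m → Bd2 L η k Ω f m → Bd2 L η k Ω (R f) (BR * m))
    (hRτ : ∀ f : Site d → 𝔸, (∀ j, j ≤ k → ∀ x ∈ Ω j, τ (f x) = 0) → ∀ j, j ≤ k → ∀ x ∈ Ω j, τ (R f x) = 0)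
    (hGτ : ∀ f : Site d → 𝔸, (∀ j, j ≤ k → ∀ x ∈ Ω j, τ (f x) = 0) → ∀ x, τ (Gp f x) = 0)
    {lam : Site d → 𝔸} (hg0 : ∀ j, j ≤ k → ∀ x ∈ Ω j, ‖gpar lam x‖ ≤ a₁)
    (hg1 : ∀ j, j ≤ k → ∀ x ∈ Ω j, ∀ μ : Fin d,
      wt L η j * ‖covDerivFwd η U₀ μ (gpar lam) x‖ ≤ b₁ ∧ wt L η j * ‖covDeriv η U₀ μ (gpar lam) x‖ ≤ b₁)
    (hE0 : Bd2 L η k Ω (Eterm lam) mE) (hDA : Bd2 L η k Ω DA cDA)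
    (hA : ∀ j, j ≤ k → ∀ x ∈ Ω j, ∀ μ : Fin d,
      wt L η j * ‖A x μ‖ ≤ cA ∧ wt L η j * ‖conjR (U₀ (x - e μ) μ)⁻¹ (A (x - e μ) μ)‖ ≤ cA)
    (hDAτ : ∀ j, j ≤ k → ∀ x ∈ Ω j, τ (DA x) = 0) (hEτ : ∀ j, j ≤ k → ∀ x ∈ Ω j, τ (Eterm lam x) = 0) :
    ∀ x, τ (Gp (PsiP5 η U₀ A DA R gpar Eterm lam) x) = 0 := by
  have hmW : 0 ≤ mWc d b₁ cA mE cDA := mWc_nonneg hb₁.le hcA hmE hcDA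
  have hcV : 0 ≤ 10 * a₁ := by positivity
  have ha12 : a₁ ≤ 1 / 12 := by linarith
  have hb70 : b₁ ≤ 1 / 70 := by linarith
  have hcA12 : cA ≤ 1 / 12 := by linarith
  have hVsub : ∀ f g : Site d → 𝔸, ∀ j, j ≤ k → ∀ x ∈ Ω j,
      Vop (gpar lam) f x - Vop (gpar lam) g x = Vop (gpar lam) (f - g) x :=
    fun f g j hj x hx => Vop_sub f g ((hg0 j hj x hx).trans ha12)
  have hVbd : ∀ f : Site d → 𝔸, ∀ j, j ≤ k → ∀ x ∈ Ω j, ‖Vop (gpar lam) f x‖ ≤ 10 * a₁ * ‖f x‖ :=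
    fun f j hj x hx => norm_Vop_le f (hg0 j hj x hx) ha12
  have hW : Bd2 L η k Ω (Wsrc η U₀ A DA (gpar lam) (Eterm lam)) (mWc d b₁ cA mE cDA) :=
    fun j hj x hx => wt_sq_norm_Wsrc_le hL hη hb70 hcA hcA12 ((hg0 j hj x hx).trans ha12) (hg1 j hj x hx) (hA j hj x hx)
      (hE0 j hj x hx) (hDA j hj x hx)
  have hWτ : ∀ j, j ≤ k → ∀ x ∈ Ω j, τ (Wsrc η U₀ A DA (gpar lam) (Eterm lam) x) = 0 := by
    intro j hj x hx
    rw [apply_Wsrc τ hτ hlog hL hη hb₁' hcA' ((hg0 j hj x hx).trans ha₁') (hg1 j hj x hx) (hA j hj x hx),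
      hDAτ j hj x hx, hEτ j hj x hx, add_zero]
  have hVτ : ∀ f : Site d → 𝔸, ∀ j, j ≤ k → ∀ x ∈ Ω j, τ (Vop (gpar lam) f x) = 0 :=
    fun f j hj x hx => apply_Vop τ hτ f ((hg0 j hj x hx).trans ha12)
  have hZτ : ∀ j, j ≤ k → ∀ x ∈ Ω j,
      τ (Zsol (Wsrc η U₀ A DA (gpar lam) (Eterm lam)) (Vop (gpar lam)) R x) = 0 :=
    fun j hj x hx => apply_zsol τ hL hη hVsub hVbd hRsub hRbd hW hcV hBR hmW hθ hWτ hVτ hj hx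
  refine hGτ _ (hRτ _ fun j hj x hx => ?_)
  show τ (-Zsol (Wsrc η U₀ A DA (gpar lam) (Eterm lam)) (Vop (gpar lam)) R x) = 0
  rw [map_neg, hZτ j hj x hx, neg_zero]

/-- ★ **THE PERIODIC FIXED POINT IS `τ`-FREE** — `B8Prop5TraceFree.propFive_fixedPoint_kLevel_traceFree` VERBATIM with the Sect.-E data and their
`τ`-laws at periodic `λ` only: the contraction run inside the closed invariant subset «periodic ∧ `τ`-free» (`B8LambdaSpaceKLevelOn.fixedPoint_kLevel_on`)
and uniqueness among the periodic fixed points. [cite: Balaban1985RegularSpaces, (1.17) p.78, p.93 (after (1.102)), (1.100) p.93, (1.107) p.94] -/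
theorem propFive_fixedPoint_kLevel_traceFree_per (hτ : ∀ x y : 𝔸, τ (x * y) = τ (y * x))
    (hlog : ∀ a b : 𝔸, ‖a‖ + ‖b‖ ≤ 1 / 2 → τ (mlog (exp a * exp b)) = τ a + τ b)
    (hL : 1 ≤ L) (hη : 0 < η) (P : ℤ)
    (Gp R gpar Eterm : (Site d → 𝔸) → (Site d → 𝔸))
    {α₄ BG BR a₁ b₁ cA cDA mE KE ℓ₀ ℓ₁ : ℝ}
    (hα₄ : 0 ≤ α₄) (hBG : 0 ≤ BG) (hBR : 0 ≤ BR) (ha₁ : 0 ≤ a₁) (ha₁' : a₁ ≤ 1 / 24) (hb₁ : 0 < b₁) (hb₁' : b₁ ≤ 1 / 140)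
    (hcA : 0 ≤ cA) (hcA' : cA ≤ 1 / 13) (hcDA : 0 ≤ cDA) (hmE : 0 ≤ mE) (hKE : 0 ≤ KE) (hℓ₀ : 0 ≤ ℓ₀) (hℓ₁ : 0 ≤ ℓ₁)
    (hθ : 10 * a₁ * BR ≤ 1 / 2)
    (hG : ∀ (f : Site d → 𝔸) (m : ℝ), 0 ≤ m → Bd2 L η k Ω f m →
      (∀ x, ‖Gp f x‖ ≤ BG * m) ∧ ∀ j, j ≤ k → ∀ p ∈ Eb j, wt L η j * ‖covDerivFwd η U₀ p.2 (Gp f) p.1‖ ≤ BG * m)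
    (hGsub : ∀ f g : Site d → 𝔸, Gp (f - g) = Gp f - Gp g)
    (hGper : ∀ (f : Site d → 𝔸) (z : Site d) (i : Fin d), Gp f (z + P • e i) = Gp f z)
    (hRsub : ∀ f g : Site d → 𝔸, R (f - g) = R f - R g)
    (hRbd : ∀ (f : Site d → 𝔸) (m : ℝ), 0 ≤ m → Bd2 L η k Ω f m → Bd2 L η k Ω (R f) (BR * m))
    (hg0 : ∀ s : lamSubK η U₀ L k Eb, (∀ (z : Site d) (i : Fin d), lamOf s (z + P • e i) = lamOf s z) → ‖s‖ ≤ α₄ / 4 →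
      ∀ j, j ≤ k → ∀ x ∈ Ω j, ‖gpar (lamOf s) x‖ ≤ a₁)
    (hg1 : ∀ s : lamSubK η U₀ L k Eb, (∀ (z : Site d) (i : Fin d), lamOf s (z + P • e i) = lamOf s z) → ‖s‖ ≤ α₄ / 4 →
      ∀ j, j ≤ k → ∀ x ∈ Ω j, ∀ μ : Fin d,
      wt L η j * ‖covDerivFwd η U₀ μ (gpar (lamOf s)) x‖ ≤ b₁ ∧ wt L η j * ‖covDeriv η U₀ μ (gpar (lamOf s)) x‖ ≤ b₁)
    (hgL : ∀ s t : lamSubK η U₀ L k Eb, (∀ (z : Site d) (i : Fin d), lamOf s (z + P • e i) = lamOf s z) → (∀ (z : Site d) (i : Fin d), lamOf t (z + P • e i) = lamOf t z) →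
      ‖s‖ ≤ α₄ / 4 → ‖t‖ ≤ α₄ / 4 → ∀ j, j ≤ k → ∀ x ∈ Ω j,
      ‖gpar (lamOf s) x - gpar (lamOf t) x‖ ≤ ℓ₀ * ‖s - t‖ ∧ ∀ μ : Fin d,
        wt L η j * ‖covDerivFwd η U₀ μ (gpar (lamOf s) - gpar (lamOf t)) x‖ ≤ ℓ₁ * ‖s - t‖ ∧
        wt L η j * ‖covDeriv η U₀ μ (gpar (lamOf s) - gpar (lamOf t)) x‖ ≤ ℓ₁ * ‖s - t‖)
    (hE0 : ∀ s : lamSubK η U₀ L k Eb, (∀ (z : Site d) (i : Fin d), lamOf s (z + P • e i) = lamOf s z) → ‖s‖ ≤ α₄ / 4 →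
      Bd2 L η k Ω (Eterm (lamOf s)) mE)
    (hEL : ∀ s t : lamSubK η U₀ L k Eb, (∀ (z : Site d) (i : Fin d), lamOf s (z + P • e i) = lamOf s z) → (∀ (z : Site d) (i : Fin d), lamOf t (z + P • e i) = lamOf t z) →
      ‖s‖ ≤ α₄ / 4 → ‖t‖ ≤ α₄ / 4 → Bd2 L η k Ω (Eterm (lamOf s) - Eterm (lamOf t)) (KE * ‖s - t‖))
    (hDA : Bd2 L η k Ω DA cDA)
    (hA : ∀ j, j ≤ k → ∀ x ∈ Ω j, ∀ μ : Fin d,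
      wt L η j * ‖A x μ‖ ≤ cA ∧ wt L η j * ‖conjR (U₀ (x - e μ) μ)⁻¹ (A (x - e μ) μ)‖ ≤ cA)
    (h103 : BG * Mc d BR b₁ cA mE cDA ≤ α₄ / 4) (h106 : BG * Kc d BR b₁ cA mE cDA KE ℓ₀ ℓ₁ ≤ 1 / 2)
    -- `τ`-freeness of the datum, the defect and the letters
    (hDAτ : ∀ j, j ≤ k → ∀ x ∈ Ω j, τ (DA x) = 0)
    (hEτ : ∀ s : lamSubK η U₀ L k Eb, (∀ (z : Site d) (i : Fin d), lamOf s (z + P • e i) = lamOf s z) → ‖s‖ ≤ α₄ / 4 →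
      (∀ x, τ (lamOf s x) = 0) → ∀ j, j ≤ k → ∀ x ∈ Ω j, τ (Eterm (lamOf s) x) = 0)
    (hRτ : ∀ f : Site d → 𝔸, (∀ j, j ≤ k → ∀ x ∈ Ω j, τ (f x) = 0) → ∀ j, j ≤ k → ∀ x ∈ Ω j, τ (R f x) = 0)
    (hGτ : ∀ f : Site d → 𝔸, (∀ j, j ≤ k → ∀ x ∈ Ω j, τ (f x) = 0) → ∀ x, τ (Gp f x) = 0)
    {s : lamSubK η U₀ L k Eb} (hp : (∀ (z : Site d) (i : Fin d), lamOf s (z + P • e i) = lamOf s z)) (hs : ‖s‖ ≤ α₄ / 4)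
    (hfix : lamOf s = Gp (PsiP5 η U₀ A DA R gpar Eterm (lamOf s))) :
    ∀ x, τ (lamOf s x) = 0 := by
  have hmW : 0 ≤ mWc d b₁ cA mE cDA := mWc_nonneg hb₁.le hcA hmE hcDA
  have hKW : 0 ≤ KWc d b₁ cA mE cDA KE ℓ₀ ℓ₁ := KWc_nonneg hb₁.le hcA hmE hcDA hKE hℓ₀ hℓ₁
  have hM0 : 0 ≤ Mc d BR b₁ cA mE cDA := by unfold Mc; positivity
  have hK0 : 0 ≤ Kc d BR b₁ cA mE cDA KE ℓ₀ ℓ₁ := by unfold Kc; positivity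
  have hΨ0 : ∀ s : lamSubK η U₀ L k Eb, (∀ (z : Site d) (i : Fin d), lamOf s (z + P • e i) = lamOf s z) → ‖s‖ ≤ α₄ / 4 →
      ∀ j, j ≤ k → ∀ x ∈ Ω j, wt L η j ^ 2 * ‖PsiP5 η U₀ A DA R gpar Eterm (lamOf s) x‖ ≤ Mc d BR b₁ cA mE cDA :=
    fun s hp hs => psiP5_bd2_at (Ω := Ω) hL hη R gpar Eterm hBR ha₁ ha₁' hb₁ hb₁' hcA hcA' hcDA hmE hθ hRsub hRbd (hg0 s hp hs) (hg1 s hp hs)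
      (hE0 s hp hs) hDA hA
  have hΨ1 : ∀ s t : lamSubK η U₀ L k Eb, (∀ (z : Site d) (i : Fin d), lamOf s (z + P • e i) = lamOf s z) →
      (∀ (z : Site d) (i : Fin d), lamOf t (z + P • e i) = lamOf t z) → ‖s‖ ≤ α₄ / 4 → ‖t‖ ≤ α₄ / 4 → ∀ j, j ≤ k → ∀ x ∈ Ω j,
      wt L η j ^ 2 * ‖PsiP5 η U₀ A DA R gpar Eterm (lamOf s) x - PsiP5 η U₀ A DA R gpar Eterm (lamOf t) x‖ ≤
        Kc d BR b₁ cA mE cDA KE ℓ₀ ℓ₁ * ‖s - t‖ := fun s t hps hpt hs ht j hj x hx => by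
    simpa only [Pi.sub_apply] using psiP5_sub_bd2_at (Ω := Ω) hL hη R gpar Eterm (norm_nonneg (s - t)) hBR ha₁ ha₁' hb₁ hb₁' hcA hcA'
      hcDA hmE hKE hℓ₀ hℓ₁ hθ hRsub hRbd (hg0 s hps hs) (hg0 t hpt ht) (hg1 s hps hs) (hg1 t hpt ht) (hgL s t hps hpt hs ht) (hE0 s hps hs)
      (hE0 t hpt ht) (hEL s t hps hpt hs ht) hDA hA j hj x hx
  -- the contraction inside «periodic ∧ τ-free»
  obtain ⟨hcl, h0τ⟩ := isClosed_traceFree_and_zero_mem τ η U₀ L k Eb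
  set S' : Set (lamSubK η U₀ L k Eb) := perSet η U₀ L k Eb P ∩ {s : lamSubK η U₀ L k Eb | ∀ x, τ (lamOf s x) = 0} with hS'
  obtain ⟨s', hs'S, hs', hfix', -⟩ := fixedPoint_kLevel_on hη.le Ω S' ((isClosed_perSet P).inter hcl) ⟨zero_mem_perSet P, h0τ⟩ Gp
    (PsiP5 η U₀ A DA R gpar Eterm) hα₄ hBG hM0 hK0 (fun f m hm hf => hG f m hm hf) hGsub (fun t htS ht => hΨ0 t htS.1 ht)
    (fun t₁ t₂ h₁ h₂ ht₁ ht₂ => hΨ1 t₁ t₂ h₁.1 h₂.1 ht₁ ht₂)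
    (fun t htS ht r hr => ⟨fun z i => by rw [hr]; exact hGper _ z i, fun x => by
      rw [hr]
      exact psiP5_traceFree_at (Ω := Ω) τ hτ hlog hL hη Gp R gpar Eterm hBR ha₁ ha₁' hb₁ hb₁' hcA hcA' hcDA hmE hθ hRsub hRbd hRτ hGτ (hg0 t htS.1 ht)
        (hg1 t htS.1 ht) (hE0 t htS.1 ht) hDA hA hDAτ (hEτ t htS.1 ht htS.2) x⟩)
    h103 h106
  -- uniqueness among the periodic fixed points
  obtain ⟨s₀, -, -, -, huniq⟩ := fixedPoint_kLevel_per hη.le Ω P Gp (PsiP5 η U₀ A DA R gpar Eterm) hα₄ hBG hM0 hK0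
    (fun f m hm hf => hG f m hm hf) hGsub hGper hΨ0 hΨ1 h103 h106
  have h1 : s = s₀ := huniq s hp hs hfix
  have h2 : s' = s₀ := huniq s' hs'S.1 hs' hfix'
  rw [h1, ← h2]
  exact hs'S.2

end CStar

#print axioms propFive_fixedPoint_kLevel_per
#print axioms propFive_fixedPoint_kLevel_spec_per
#print axioms propFive_fixedPoint_kLevel_selfAdjoint_per
#print axioms propFive_fixedPoint_kLevel_traceFree_per

end Literature.MathematicalPhysics.QuantumFieldTheory.Balaban1983to89.B8Prop5ContractionKLevelPer

end
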